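/-
Copyright: lead seat `ym-line-sll-p1` (prover-ym-line-sll-p1-g0-0), route `SoftLoopLongLag`, crux `ColdBoxSoftLoopLagFloor`
(stmt-QuantumFields-24180; stubs E1a `stub_innerFlatLagFloorG`, E1b `stub_innerDatumCovStabilityG` of `Cruxes/ColdBoxSoftLoopLagFloor/Lines/birth.lean` v7).
-/
import Summits.QuantumFields.YangMills.Theorems.WeakCouplingRatesColdBoxDirichletShiftedCov
import HarnessLib

/-!
# Covariance of shifted quadratic observables of a centred Gaussian process, with colours (route `SoftLoopLongLag`, G-free, model-free)

WHAT.  For a centred real Gaussian process `X : T → Ω → ℝ` under a probability measure `P` (Mathlib `IsGaussianProcess`), with kernel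
`K(a,b) = E[X_a X_b]` (written out as `∫ X_a X_b dP`; no definition is introduced), and real constants `F, G` ("background circulations"):
* `integral_gp_mul_sq` — `E[X_a X_b²] = 0`; `integral_gp_sq_mul_sq` — `E[X_a² X_b²] = K(a,a)K(b,b) + 2K(a,b)²` (Wick, tree `GaussianWick`);
* `integral_gp_const_add_sq` — `E[(F + X_a)²] = F² + K(a,a)`;
* `cov_gp_const_add_sq` — `Cov((F + X_a)², (G + X_b)²) = 4FG·K(a,b) + 2K(a,b)²`;
* `cov_gp_quad_pi_eq` — with `ι` independent colour copies (`P^{⊗ι}`) and colour-dependent constants,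
  `Cov(½Σ_c (F_c + X_a(ω_c))², ½Σ_c (G_c + X_b(ω_c))²) = (|ι|/2)·K(a,b)² + (Σ_c F_cG_c)·K(a,b)` EXACTLY.
This is the abstract form of the tree's plaquette computation `WeakCouplingRates.cov_quadObs_pi_eq` (three colours, `X = dirCirc H`); the route
`SoftLoopLongLag` instantiates it with SURFACE circulations `X = dirSurfCirc H` (loops; file `SoftLoopLongLagDirichletLoopSurrogate`) and `D = dimE r.ρ`
colours: the Gaussian main term of stubs E1a (flat, `F = G = 0`: `(D/2)·M_D²`) and E1b (datum: `+ (Σ_c F_cG_c)·M_D`, the LINEAR background term whose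
sign is controlled by the landed lag positivity / odd-symmetry files).

HONEST LABEL.  Gaussian bookkeeping for a RECORD-label rung line (R2xi-G, leaf `WeakCouplingRates.XiPow` = an UPPER bound on the lattice mass gap,
all compact simple `G`); NOT the Clay mass gap; no summit statement is touched.

References: S. Janson, *Gaussian Hilbert Spaces* (1997) Thm 1.28; L. Isserlis, Biometrika 12 (1918).
-/

set_option autoImplicit false

noncomputable section

open MeasureTheory ProbabilityTheory Finset
open scoped ENNReal
open Literature.Probability.Distributions

namespace Summit.QuantumFields.YangMills.Theorems.SoftLoopLongLag

section OneColour

variable {T Ω : Type*} [MeasurableSpace Ω] {P : Measure Ω} {X : T → Ω → ℝ}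

/-- `E[X_a²] = K(a,a)`. -/
theorem integral_gp_sq (a : T) : ∫ ω, X a ω ^ 2 ∂P = (∫ ω, X a ω * X a ω ∂P) :=
  integral_congr_ae (ae_of_all _ fun ω => by simp only [sq])

variable (hX : IsGaussianProcess X P) (h0 : ∀ t, ∫ ω, X t ω ∂P = 0)
include hX

/-- Every coordinate has moments of all orders. -/
theorem memLp_gp (a : T) {p : ℝ≥0∞} (hp : p ≠ ∞) : MemLp (X a) p P := (hX.hasGaussianLaw_eval a).memLp hp

/-- All finite products of coordinates are integrable. -/
theorem integrable_gp_prod {κ : Type*} (s : Finset κ) (t : κ → T) : Integrable (fun ω => ∏ i ∈ s, X (t i) ω) P :=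
  GaussianWick.integrable_prod hX s t

include h0

/-- **Odd moment**: `E[X_a · X_b²] = 0`. -/
theorem integral_gp_mul_sq (a b : T) : ∫ ω, X a ω * X b ω ^ 2 ∂P = 0 := by
  have h : ∫ ω, ∏ i : Fin 3, X ((![a, b, b] : Fin 3 → T) i) ω ∂P = 0 := GaussianWick.integral_prod_odd_eq_zero hX h0 1 ![a, b, b]
  have hl : ∀ ω, ∏ i : Fin 3, X ((![a, b, b] : Fin 3 → T) i) ω = X a ω * X b ω ^ 2 := by
    intro ω
    simp only [Fin.prod_univ_three, Matrix.cons_val_zero, Matrix.cons_val_one, Matrix.cons_val]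
    ring
  simp_rw [hl] at h
  exact h

/-- **Fourth mixed moment (Wick)**: `E[X_a² · X_b²] = K(a,a)K(b,b) + 2K(a,b)²`. -/
theorem integral_gp_sq_mul_sq (a b : T) :
    ∫ ω, X a ω ^ 2 * X b ω ^ 2 ∂P = (∫ ω, X a ω * X a ω ∂P) * (∫ ω, X b ω * X b ω ∂P) + 2 * (∫ ω, X a ω * X b ω ∂P) ^ 2 := by
  have h := GaussianWick.integral_prod_four hX h0 ![a, a, b, b]
  simp only [Matrix.cons_val_zero, Matrix.cons_val_one, Matrix.cons_val] at h
  have hl : ∀ ω, X a ω * X a ω * X b ω * X b ω = X a ω ^ 2 * X b ω ^ 2 := fun ω => by ring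
  simp_rw [hl] at h
  rw [h]
  ring

/-- **Shifted second moment**: `E[(F + X_a)²] = F² + K(a,a)`. -/
theorem integral_gp_const_add_sq (F : ℝ) (a : T) : ∫ ω, (F + X a ω) ^ 2 ∂P = F ^ 2 + (∫ ω, X a ω * X a ω ∂P) := by
  haveI := hX.isProbabilityMeasure
  have hXi : Integrable (X a) P := (memLp_gp hX a (by norm_num : (2 : ℝ≥0∞) ≠ ∞)).integrable one_le_two
  have hX2 : Integrable (fun ω => X a ω ^ 2) P := (memLp_gp hX a (by norm_num : (2 : ℝ≥0∞) ≠ ∞)).integrable_sq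
  have hsplit : ∀ ω, (F + X a ω) ^ 2 = F ^ 2 + (2 * F * X a ω + X a ω ^ 2) := fun ω => by ring
  simp_rw [hsplit]
  have hlin : Integrable (fun ω => 2 * F * X a ω + X a ω ^ 2) P := (hXi.const_mul _).add hX2
  rw [integral_add (integrable_const _) hlin, integral_add (hXi.const_mul _) hX2, integral_const,
    integral_const_mul, h0, integral_gp_sq, smul_eq_mul, probReal_univ]
  ring

/-- **Shifted mixed moment**: `E[(F+X_a)²(G+X_b)²] = F²G² + F²K(b,b) + G²K(a,a) + K(a,a)K(b,b) + 4FG·K(a,b) + 2K(a,b)²`. -/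
theorem integral_gp_const_add_sq_mul_const_add_sq (F G : ℝ) (a b : T) :
    ∫ ω, (F + X a ω) ^ 2 * (G + X b ω) ^ 2 ∂P =
      F ^ 2 * G ^ 2 + F ^ 2 * (∫ ω, X b ω * X b ω ∂P) + G ^ 2 * (∫ ω, X a ω * X a ω ∂P) + (∫ ω, X a ω * X a ω ∂P) * (∫ ω, X b ω * X b ω ∂P) +
        4 * F * G * (∫ ω, X a ω * X b ω ∂P) + 2 * (∫ ω, X a ω * X b ω ∂P) ^ 2 := by
  haveI := hX.isProbabilityMeasure
  have m2 : ∀ t, MemLp (X t) 2 P := fun t => memLp_gp hX t (by norm_num)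
  have i1 : Integrable (X b) P := (m2 b).integrable one_le_two
  have i2 : Integrable (X a) P := (m2 a).integrable one_le_two
  have i3 : Integrable (fun ω => X b ω ^ 2) P := (m2 b).integrable_sq
  have i4 : Integrable (fun ω => X a ω ^ 2) P := (m2 a).integrable_sq
  have i5 : Integrable (fun ω => X a ω * X b ω) P := (m2 a).integrable_mul (m2 b)
  have i6 : Integrable (fun ω => X a ω * X b ω ^ 2) P := by
    refine (integrable_gp_prod hX Finset.univ ![a, b, b]).congr (ae_of_all _ fun ω => ?_)
    simp only [Fin.prod_univ_three, Matrix.cons_val_zero, Matrix.cons_val_one, Matrix.cons_val]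
    ring
  have i7 : Integrable (fun ω => X a ω ^ 2 * X b ω) P := by
    refine (integrable_gp_prod hX Finset.univ ![a, a, b]).congr (ae_of_all _ fun ω => ?_)
    simp only [Fin.prod_univ_three, Matrix.cons_val_zero, Matrix.cons_val_one, Matrix.cons_val]
    ring
  have i8 : Integrable (fun ω => X a ω ^ 2 * X b ω ^ 2) P := by
    refine (integrable_gp_prod hX Finset.univ ![a, a, b, b]).congr (ae_of_all _ fun ω => ?_)
    simp only [Fin.prod_univ_four, Matrix.cons_val_zero, Matrix.cons_val_one, Matrix.cons_val]
    ring
  have v7 : ∫ ω, X a ω ^ 2 * X b ω ∂P = 0 := by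
    rw [← integral_gp_mul_sq hX h0 b a]
    exact integral_congr_ae (ae_of_all _ fun ω => by ring)
  have hexp : ∀ ω, (F + X a ω) ^ 2 * (G + X b ω) ^ 2 =
      F ^ 2 * G ^ 2 + (2 * F ^ 2 * G) * X b ω + F ^ 2 * X b ω ^ 2 + (2 * F * G ^ 2) * X a ω + (4 * F * G) * (X a ω * X b ω) +
        (2 * F) * (X a ω * X b ω ^ 2) + G ^ 2 * X a ω ^ 2 + (2 * G) * (X a ω ^ 2 * X b ω) + X a ω ^ 2 * X b ω ^ 2 := fun ω => by ring
  simp_rw [hexp]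
  have hS1 : Integrable (fun _ : Ω => F ^ 2 * G ^ 2) P := integrable_const _
  have hS2 : Integrable (fun ω => F ^ 2 * G ^ 2 + (2 * F ^ 2 * G) * X b ω) P := hS1.add (i1.const_mul (2 * F ^ 2 * G))
  have hS3 : Integrable (fun ω => F ^ 2 * G ^ 2 + (2 * F ^ 2 * G) * X b ω + F ^ 2 * X b ω ^ 2) P := hS2.add (i3.const_mul (F ^ 2))
  have hS4 : Integrable (fun ω => F ^ 2 * G ^ 2 + (2 * F ^ 2 * G) * X b ω + F ^ 2 * X b ω ^ 2 + (2 * F * G ^ 2) * X a ω) P := hS3.add (i2.const_mul (2 * F * G ^ 2))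
  have hS5 : Integrable (fun ω => F ^ 2 * G ^ 2 + (2 * F ^ 2 * G) * X b ω + F ^ 2 * X b ω ^ 2 + (2 * F * G ^ 2) * X a ω + (4 * F * G) * (X a ω * X b ω)) P := hS4.add (i5.const_mul (4 * F * G))
  have hS6 : Integrable (fun ω => F ^ 2 * G ^ 2 + (2 * F ^ 2 * G) * X b ω + F ^ 2 * X b ω ^ 2 + (2 * F * G ^ 2) * X a ω + (4 * F * G) * (X a ω * X b ω) + (2 * F) * (X a ω * X b ω ^ 2)) P := hS5.add (i6.const_mul (2 * F))
  have hS7 : Integrable (fun ω => F ^ 2 * G ^ 2 + (2 * F ^ 2 * G) * X b ω + F ^ 2 * X b ω ^ 2 + (2 * F * G ^ 2) * X a ω + (4 * F * G) * (X a ω * X b ω) + (2 * F) * (X a ω * X b ω ^ 2) + G ^ 2 * X a ω ^ 2) P := hS6.add (i4.const_mul (G ^ 2))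
  have hS8 : Integrable (fun ω => F ^ 2 * G ^ 2 + (2 * F ^ 2 * G) * X b ω + F ^ 2 * X b ω ^ 2 + (2 * F * G ^ 2) * X a ω + (4 * F * G) * (X a ω * X b ω) + (2 * F) * (X a ω * X b ω ^ 2) + G ^ 2 * X a ω ^ 2 + (2 * G) * (X a ω ^ 2 * X b ω)) P := hS7.add (i7.const_mul (2 * G))
  rw [integral_add hS8 i8, integral_add hS7 (i7.const_mul _), integral_add hS6 (i4.const_mul _), integral_add hS5 (i6.const_mul _),
    integral_add hS4 (i5.const_mul _), integral_add hS3 (i2.const_mul _), integral_add hS2 (i3.const_mul _),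
    integral_add hS1 (i1.const_mul _)]
  rw [integral_const, integral_const_mul, integral_const_mul, integral_const_mul, integral_const_mul, integral_const_mul,
    integral_const_mul, integral_const_mul, h0, h0, integral_gp_sq, integral_gp_sq, integral_gp_mul_sq hX h0, v7,
    integral_gp_sq_mul_sq hX h0, smul_eq_mul, probReal_univ]
  ring

/-- **Shifted one-colour covariance**: `Cov((F+X_a)², (G+X_b)²) = 4FG·K(a,b) + 2K(a,b)²`. -/
theorem cov_gp_const_add_sq (F G : ℝ) (a b : T) :
    (∫ ω, (F + X a ω) ^ 2 * (G + X b ω) ^ 2 ∂P) - (∫ ω, (F + X a ω) ^ 2 ∂P) * (∫ ω, (G + X b ω) ^ 2 ∂P) =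
      4 * F * G * (∫ ω, X a ω * X b ω ∂P) + 2 * (∫ ω, X a ω * X b ω ∂P) ^ 2 := by
  rw [integral_gp_const_add_sq_mul_const_add_sq hX h0, integral_gp_const_add_sq hX h0, integral_gp_const_add_sq hX h0]
  ring

omit h0 in
/-- `(F + X_a)² ∈ L²(P)` (Gaussian fourth moment). -/
theorem memLp_two_gp_const_add_sq (F : ℝ) (a : T) : MemLp (fun ω => (F + X a ω) ^ 2) 2 P := by
  haveI := hX.isProbabilityMeasure
  have h4 : MemLp (fun ω => F + X a ω) ((4 : ℕ) : ℝ≥0∞) P := (memLp_const F).add (memLp_gp hX a (by simp))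
  have hi : Integrable (fun ω => (F + X a ω) ^ 4) P := by
    refine (h4.integrable_norm_pow (by norm_num)).congr (ae_of_all _ fun ω => ?_)
    simp only [Real.norm_eq_abs]; exact (show Even 4 by decide).pow_abs _
  have h2 : Integrable (fun ω => (F + X a ω) ^ 2) P :=
    ((memLp_const F).add (memLp_gp hX a (by norm_num : (2 : ℝ≥0∞) ≠ ∞))).integrable_sq
  rw [memLp_two_iff_integrable_sq h2.aestronglyMeasurable]
  exact hi.congr (ae_of_all _ fun ω => by simp only; ring)

end OneColour

/-! ## Colours: the product measure `P^{⊗ι}` -/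

section Colours

variable {T Ω ι : Type*} [MeasurableSpace Ω] {P : Measure Ω} [IsProbabilityMeasure P] {X : T → Ω → ℝ} [Fintype ι] [DecidableEq ι]

omit [DecidableEq ι] in
/-- Integrability transfers from one colour to the product. -/
theorem integrable_comp_eval_piGP {g : Ω → ℝ} (hg : Integrable g P) (c : ι) :
    Integrable (fun w : ι → Ω => g (w c)) (Measure.pi fun _ : ι => P) := by
  have hmp := MeasureTheory.measurePreserving_eval (μ := fun _ : ι => P) c
  exact (hmp.integrable_comp hg.aestronglyMeasurable).2 hg

/-- **Colours, exact covariance of shifted quadratic observables**: with `f = ½Σ_c (F_c + X_a(ω_c))²`, `g = ½Σ_c (G_c + X_b(ω_c))²`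
under `P^{⊗ι}`, `E[fg] − E[f]E[g] = (|ι|/2)·K(a,b)² + (Σ_c F_cG_c)·K(a,b)`. -/
theorem cov_gp_quad_pi_eq (hX : IsGaussianProcess X P) (h0 : ∀ t, ∫ ω, X t ω ∂P = 0) (F G : ι → ℝ) (a b : T) :
    (∫ w : ι → Ω, ((1 / 2 : ℝ) * ∑ c, (F c + X a (w c)) ^ 2) * ((1 / 2 : ℝ) * ∑ c, (G c + X b (w c)) ^ 2)
          ∂(Measure.pi fun _ : ι => P)) -
        (∫ w : ι → Ω, (1 / 2 : ℝ) * ∑ c, (F c + X a (w c)) ^ 2 ∂(Measure.pi fun _ : ι => P)) *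
          (∫ w : ι → Ω, (1 / 2 : ℝ) * ∑ c, (G c + X b (w c)) ^ 2 ∂(Measure.pi fun _ : ι => P)) =
      (Fintype.card ι : ℝ) / 2 * (∫ ω, X a ω * X b ω ∂P) ^ 2 + (∑ c, F c * G c) * (∫ ω, X a ω * X b ω ∂P) := by
  set Pm := Measure.pi fun _ : ι => P with hPm
  have hu : ∀ c : ι, MemLp (fun ω => (F c + X a ω) ^ 2) 2 P := fun c => memLp_two_gp_const_add_sq hX (F c) a
  have hw : ∀ c : ι, MemLp (fun ω => (G c + X b ω) ^ 2) 2 P := fun c => memLp_two_gp_const_add_sq hX (G c) b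
  have hcov := WeakCouplingRates.cov_sum_pi_eq_sum_cov P (fun c ω => (F c + X a ω) ^ 2) (fun c ω => (G c + X b ω) ^ 2) hu hw
  simp only at hcov
  have e1 : ∫ w, ((1 / 2 : ℝ) * ∑ c, (F c + X a (w c)) ^ 2) * ((1 / 2 : ℝ) * ∑ c, (G c + X b (w c)) ^ 2) ∂Pm =
      1 / 4 * ∫ w, (∑ c, (F c + X a (w c)) ^ 2) * (∑ c, (G c + X b (w c)) ^ 2) ∂Pm := by
    rw [← integral_const_mul]
    exact integral_congr_ae (ae_of_all _ fun w => by ring)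
  rw [e1, integral_const_mul, integral_const_mul]
  have e2 : 1 / 4 * (∫ w, (∑ c, (F c + X a (w c)) ^ 2) * (∑ c, (G c + X b (w c)) ^ 2) ∂Pm) -
      1 / 2 * (∫ w, ∑ c, (F c + X a (w c)) ^ 2 ∂Pm) * (1 / 2 * ∫ w, ∑ c, (G c + X b (w c)) ^ 2 ∂Pm) =
      1 / 4 * ((∫ w, (∑ c, (F c + X a (w c)) ^ 2) * (∑ c, (G c + X b (w c)) ^ 2) ∂Pm) -
        (∫ w, ∑ c, (F c + X a (w c)) ^ 2 ∂Pm) * (∫ w, ∑ c, (G c + X b (w c)) ^ 2 ∂Pm)) := by ring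
  rw [e2, hPm, hcov]
  simp_rw [cov_gp_const_add_sq hX h0]
  rw [Finset.sum_add_distrib, Finset.sum_const, Finset.card_univ, ← Finset.sum_mul]
  simp only [nsmul_eq_mul]
  have : ∑ c, 4 * F c * G c = 4 * ∑ c, F c * G c := by rw [Finset.mul_sum]; exact Finset.sum_congr rfl fun c _ => by ring
  rw [this]
  ring

/-- **Flat case** (`F = G = 0`): `Cov(½Σ_c X_a(ω_c)², ½Σ_c X_b(ω_c)²) = (|ι|/2)·K(a,b)²`. -/
theorem cov_gp_quad_pi_flat_eq (hX : IsGaussianProcess X P) (h0 : ∀ t, ∫ ω, X t ω ∂P = 0) (a b : T) :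
    (∫ w : ι → Ω, ((1 / 2 : ℝ) * ∑ c, X a (w c) ^ 2) * ((1 / 2 : ℝ) * ∑ c, X b (w c) ^ 2) ∂(Measure.pi fun _ : ι => P)) -
        (∫ w : ι → Ω, (1 / 2 : ℝ) * ∑ c, X a (w c) ^ 2 ∂(Measure.pi fun _ : ι => P)) *
          (∫ w : ι → Ω, (1 / 2 : ℝ) * ∑ c, X b (w c) ^ 2 ∂(Measure.pi fun _ : ι => P)) =
      (Fintype.card ι : ℝ) / 2 * (∫ ω, X a ω * X b ω ∂P) ^ 2 := by
  have h := cov_gp_quad_pi_eq (ι := ι) hX h0 (fun _ => 0) (fun _ => 0) a b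
  simp only [zero_add, mul_zero, Finset.sum_const_zero, zero_mul, add_zero] at h
  exact h

end Colours

end Summit.QuantumFields.YangMills.Theorems.SoftLoopLongLag

end
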